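import Summits.Ventures.LatticeQCDFlow.Scaling.FlowLadderConjugacy
import Summits.Ventures.LatticeQCDFlow.Scaling.SimulatedTemperingFlowSampler
import Summits.Ventures.LatticeQCDFlow.Scaling.SimulatedTemperingFrozenCold

/-!
HONEST FRAMING: exact (Metropolis-corrected) sampling algorithms for lattice gauge theory; figures
of merit are autocorrelation/cost numbers at stated couplings and volumes; no continuum-physics
claim.

# FlowTemperingConjugacy — SIMULATED TEMPERING WITH TRANSPORT MAPS IS PLAIN SIMULATED TEMPERING IN LEVEL COORDINATES:
# `stFlowSampler t μ M φ^L ((k,x),(l,y)) = stFinSampler t ν M^L ((k,L_k x),(l,L_l y))` WITH `ν_k = μ_k∘L_k⁻¹`, SO THE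
# SPECTRAL GAPS AGREE; ADJACENT MAPS TRANSPORTING EACH LEVEL ONTO THE NEXT GIVE, WITH FROZEN (ARBITRARY) COLD UPDATES,
# `Gap(stFlowSampler ½ μ M φ) ≥ min{1/K, γ₀}/(25(K+1))` WHATEVER THE COLD LAWS (lean-2 GEN-21, ours)

Venture-side (OURS).  Cell `lqcd-flow` (pub-lqcd), unit `pub-lqcd-lean-2-g21`, 2026-08-26.  Chapter I, fourth file: the
tempering twin of `Scaling/FlowLadderConjugacy`.  `stFlowSampler t μ M φ` (`Scaling/SimulatedTemperingFlowSampler`, F3):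
the walker at level `j` with configuration `x` proposes `(j+1, φ_j x)`, at level `j+1` proposes `(j, φ_j⁻¹ x)`, each
with probability `½`, Metropolis-corrected for `π(k,x) = μ_k(x)/(K+1)`; with probability `1 − t` a within-level update
`M_k`.  In the level coordinates `(k, x) ↦ (k, L_k x)` with `φ_j = L_{j+1}⁻¹∘L_j` a transport move KEEPS the
coordinate and changes the level — it is the plain level move of `stFinSampler` (`Scaling/SimulatedTemperingFiniteSampler`)
for the pulled-back laws `ν_k = μ_k∘L_k⁻¹` and the conjugated updates `M^L_k` (§1), so by `spectralGap_conj`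
(`Scaling/FlowHubSchemeFloor`) every spectral statement about plain tempering ladders holds for tempering with maps, with
overlaps of the pulled-back laws in place of raw overlaps (§2).  `Scaling/SimulatedTemperingFlowTorpid` (F4, landed
today) is the ceiling side of the same object for sector-preserving maps; this file is the floor side.

## What is proved

* §1 `stFlowProposal_relabel_up`, **`stFlowProposal_ladderRelabel`** (`T^φ(p,q) = T^1(Ψp, Ψq)`), `stFinLaw_relabel`,
  `stFinWithin_conj`, **`stFlowSampler_eq_conj`**, **`stFlowSampler_spectralGap_eq_conj`**
  (`Gap_π(stFlowSampler t μ M φ^L) = Gap_{π_ν}(stFinSampler t ν M^L)`).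
* §2 **`flowTempering_spectralGap_ge_frozen`** — `Scaling/SimulatedTemperingFrozenCold` in level coordinates: transport
  persistence `p·ν_l ≤ ν_k` (`k ≤ l`), hot Poincaré constant `γ₀`, ARBITRARY `μ_k`-reversible cold updates (even the
  identity): `Gap(stFlowSampler ½ μ M φ^L) ≥ p·min{1/K, γ₀}/(25(K+1))`; **`flowTemperingPerfect_spectralGap_ge`** and its
  `φ`-form **`flowTemperingPerfect_spectralGap_ge_of_adjacent`**: `μ_{j+1}(φ_j u) = μ_j(u)` for all `j` ⇒
  `Gap(stFlowSampler ½ μ M φ) ≥ min{1/K, γ₀}/(25(K+1))` for EVERY family of cold laws.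

Reading (no numerics implied): perfect adjacent transports make the tempering walker's level moves rejection-free and the
ladder's overlaps irrelevant; what is left is the order-`K²` price of a reversible walk over `K+1` levels fed by the hot
update alone — the same order as the identical-level ladder, and (by `Scaling/LevelSchemeSectorCeiling` /
`SimulatedTemperingFlowTorpid`) no tunnelling is created by sector-preserving maps.  NOT CLAIMED: continuous configuration
spaces; non-bijective maps; anything measured.  Literature grade (cell rule): OWN MECHANISM, NEW TYPING; nothing cited as
a fact; no new bib keys.
-/

noncomputable section

open Finset Function
open Literature.Probability.MarkovChains

namespace Summit.Ventures.LatticeQCDFlow.Scaling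

variable {S : Type*} [Fintype S] [DecidableEq S] {K : ℕ} {μ : Fin (K + 1) → S → ℝ}
  {M : Fin (K + 1) → Matrix S S ℝ} {t : ℝ}

/-! ## §1 Level coordinates for the tempering walker -/

section Conj
variable (L : Fin (K + 1) → Equiv.Perm S)

omit [Fintype S] in
/-- The up pair: `T^φ((j,x),(j+1,y)) = T^1((j, L_j x),(j+1, L_{j+1} y))` for `φ_j = L_{j+1}⁻¹∘L_j`. [ours] -/
theorem stFlowProposal_relabel_up (j : Fin K) (x y : S) :
    stFlowProposal (fun j : Fin K => (L j.castSucc).trans (L j.succ).symm) (j.castSucc, x) (j.succ, y)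
      = stFinProposal ((j.castSucc, L j.castSucc x) : Fin (K + 1) × S) (j.succ, L j.succ y) := by
  unfold stFinProposal
  have hadj : ((j.succ : Fin (K + 1)).val = (j.castSucc : Fin (K + 1)).val + 1
      ∨ (j.castSucc : Fin (K + 1)).val = (j.succ : Fin (K + 1)).val + 1) := Or.inl (by simp)
  by_cases hy : y = (L j.succ).symm (L j.castSucc x)
  · subst hy
    have h := stFlowProposal_up_eq (fun j : Fin K => (L j.castSucc).trans (L j.succ).symm) j x
    simp only [Equiv.trans_apply] at h
    rw [h, if_pos ⟨by simp, hadj⟩]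
  · rw [stFlowProposal_eq_zero_of_not_image, if_neg]
    · rintro ⟨h, -⟩
      exact hy (by rw [← (show L j.succ y = L j.castSucc x from h), Equiv.symm_apply_apply])
    · intro i hi heq
      have hij : j = i := Fin.castSucc_injective _ hi
      subst hij
      simp only [Equiv.trans_apply, Prod.mk.injEq, true_and] at heq
      exact hy heq
    · intro i hi heq
      have e1 := congrArg Fin.val (hi : (j.castSucc : Fin (K + 1)) = i.succ)
      have e2 := congrArg Fin.val (congrArg Prod.fst heq : (j.succ : Fin (K + 1)) = i.castSucc)
      simp only [Fin.val_castSucc, Fin.val_succ] at e1 e2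
      omega

omit [Fintype S] in
/-- **The transport proposal in level coordinates is the plain level proposal:** `T^φ(p,q) = T^1(Ψp, Ψq)`,
`Ψ(k,x) = (k, L_k x)`. [ours] -/
theorem stFlowProposal_ladderRelabel (p q : Fin (K + 1) × S) :
    stFlowProposal (fun j : Fin K => (L j.castSucc).trans (L j.succ).symm) p q
      = stFinProposal ((p.1, L p.1 p.2) : Fin (K + 1) × S) (q.1, L q.1 q.2) := by
  obtain ⟨k, x⟩ := p
  obtain ⟨l, y⟩ := q
  by_cases hup : l.val = k.val + 1
  · have hk : k.val < K := by have := l.isLt; omega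
    obtain ⟨j, rfl, rfl⟩ : ∃ j : Fin K, k = j.castSucc ∧ l = j.succ :=
      ⟨⟨k.val, hk⟩, Fin.ext rfl, Fin.ext (by simp only [Fin.val_succ]; omega)⟩
    exact stFlowProposal_relabel_up L j x y
  · by_cases hdown : k.val = l.val + 1
    · have hl : l.val < K := by have := k.isLt; omega
      obtain ⟨j, rfl, rfl⟩ : ∃ j : Fin K, l = j.castSucc ∧ k = j.succ :=
        ⟨⟨l.val, hl⟩, Fin.ext rfl, Fin.ext (by simp only [Fin.val_succ]; omega)⟩
      rw [stFlowProposal_symm, stFinProposal_symm]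
      exact stFlowProposal_relabel_up L j y x
    · -- not adjacent: both proposals vanish
      rw [stFlowProposal_eq_zero_of_not_image]
      · unfold stFinProposal
        rw [if_neg]
        rintro ⟨-, h | h⟩
        · exact hup h
        · exact hdown h
      · intro i hi heq
        have e2 := congrArg Fin.val (congrArg Prod.fst heq : l = i.succ)
        have e1 := congrArg Fin.val (hi : k = i.castSucc)
        simp only [Fin.val_castSucc, Fin.val_succ] at e1 e2
        omega
      · intro i hi heq
        have e2 := congrArg Fin.val (congrArg Prod.fst heq : l = i.castSucc)
        have e1 := congrArg Fin.val (hi : k = i.succ)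
        simp only [Fin.val_castSucc, Fin.val_succ] at e1 e2
        omega

omit [Fintype S] [DecidableEq S] in
/-- The tempering law in level coordinates: `π_μ(k,x) = π_ν(k, L_k x)`, `ν_k = μ_k∘L_k⁻¹`. [ours] -/
theorem stFinLaw_relabel (μ : Fin (K + 1) → S → ℝ) (p : Fin (K + 1) × S) :
    stFinLaw μ p = stFinLaw (fun i u => μ i ((L i).symm u)) (p.1, L p.1 p.2) := by
  unfold stFinLaw
  simp only [Equiv.symm_apply_apply]

omit [Fintype S] [DecidableEq S] in
/-- Within-level updates relabel level by level: `W_M(p,q) = W_{M^L}(Ψp, Ψq)`. [ours] -/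
theorem stFinWithin_conj (M : Fin (K + 1) → Matrix S S ℝ) (p q : Fin (K + 1) × S) :
    stFinWithin M p q
      = stFinWithin (fun i => Matrix.of fun u v => M i ((L i).symm u) ((L i).symm v)) (p.1, L p.1 p.2) (q.1, L q.1 q.2) := by
  rw [stFinWithin_apply, stFinWithin_apply]
  by_cases h : q.1 = p.1
  · rw [if_pos h, if_pos h, Matrix.of_apply, h, Equiv.symm_apply_apply, Equiv.symm_apply_apply]
  · rw [if_neg h, if_neg h]

/-- **THE CONJUGACY:** `stFlowSampler t μ M φ^L (p,q) = stFinSampler t ν M^L (Ψp, Ψq)`. [ours] -/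
theorem stFlowSampler_eq_conj (hμ : ∀ k x, 0 < μ k x) (t : ℝ) (M : Fin (K + 1) → Matrix S S ℝ) (p q : Fin (K + 1) × S) :
    stFlowSampler t μ M (fun j : Fin K => (L j.castSucc).trans (L j.succ).symm) p q
      = stFinSampler t (fun i u => μ i ((L i).symm u)) (fun i => Matrix.of fun u v => M i ((L i).symm u) ((L i).symm v))
          (p.1, L p.1 p.2) (q.1, L q.1 q.2) := by
  have _ := hμ
  rw [stFlowSampler_apply, stFinSampler_apply]
  congr 2
  · unfold stFlowLevel stFinLevel
    have h := mhKernel_conj (Equiv.prodCongrRight L)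
      (T := stFlowProposal (fun j : Fin K => (L j.castSucc).trans (L j.succ).symm)) (T' := stFinProposal)
      (π := stFinLaw μ) (π' := stFinLaw (fun i u => μ i ((L i).symm u)))
      (fun a b => by rw [Equiv.prodCongrRight_apply, Equiv.prodCongrRight_apply]; exact stFlowProposal_ladderRelabel L a b)
      (fun a => by rw [Equiv.prodCongrRight_apply]; exact stFinLaw_relabel L μ a) p q
    rw [Equiv.prodCongrRight_apply, Equiv.prodCongrRight_apply] at h
    exact h
  · exact stFinWithin_conj L M p q

/-- **THE SPECTRAL GAP OF TEMPERING WITH MAPS IS THAT OF THE CONJUGATE PLAIN LADDER:**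
`Gap_π(stFlowSampler t μ M φ^L) = Gap_{π_ν}(stFinSampler t ν M^L)`. [ours] -/
theorem stFlowSampler_spectralGap_eq_conj (hμ : ∀ k x, 0 < μ k x) (t : ℝ) (M : Fin (K + 1) → Matrix S S ℝ) :
    spectralGap (stFinLaw μ) (stFlowSampler t μ M (fun j : Fin K => (L j.castSucc).trans (L j.succ).symm))
      = spectralGap (stFinLaw (fun i u => μ i ((L i).symm u)))
          (stFinSampler t (fun i u => μ i ((L i).symm u))
            (fun i => Matrix.of fun u v => M i ((L i).symm u) ((L i).symm v))) := by
  refine Eq.trans ?_ (spectralGap_conj (Equiv.prodCongrRight L) _ _)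
  congr 1
  · funext p; rw [Equiv.prodCongrRight_apply]; exact stFinLaw_relabel L μ p
  · funext p q; rw [Equiv.prodCongrRight_apply, Equiv.prodCongrRight_apply]; exact stFlowSampler_eq_conj L hμ t M p q

/-! ## §2 The frozen-cold floor in level coordinates; perfect transports -/

/-- **TEMPERING WITH MAPS AND FROZEN COLD LEVELS (`SimulatedTemperingFrozenCold` in level coordinates):** with
`ν_k = μ_k∘L_k⁻¹` (`L_0 = 1`), transport persistence `p·ν_l(u) ≤ ν_k(u)` (`k ≤ l`, `0 < p ≤ 1`), hot Poincaré constant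
`γ₀`, ARBITRARY `μ_k`-reversible cold updates: `Gap(stFlowSampler ½ μ M φ^L) ≥ p·min{1/K, γ₀}/(25(K+1))`. [ours] -/
theorem flowTempering_spectralGap_ge_frozen (hL0 : L 0 = Equiv.refl S) (hK : 1 ≤ K) (hμ : ∀ k x, 0 < μ k x)
    (hμ1 : ∀ k, ∑ x, μ k x = 1) (hM : ∀ k, IsRowStochastic (M k)) (hMrev : ∀ k, DetailedBalance (μ k) (M k))
    {p γ₀ : ℝ} (hp : 0 < p) (hp1 : p ≤ 1) (hγ₀ : 0 < γ₀)
    (hpers : ∀ (k l : Fin (K + 1)) (u : S), k ≤ l → p * μ l ((L l).symm u) ≤ μ k ((L k).symm u))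
    (hgap0 : ∀ h : S → ℝ, γ₀ * lawVariance (μ 0) h ≤ dirichletForm (μ 0) (M 0) h) :
    p * min (1 / (K : ℝ)) γ₀ / (25 * (K + 1))
      ≤ spectralGap (stFinLaw μ) (stFlowSampler (1 / 2) μ M (fun j : Fin K => (L j.castSucc).trans (L j.succ).symm)) := by
  rw [stFlowSampler_spectralGap_eq_conj L hμ]
  have hL0u : ∀ u, (L 0).symm u = u := fun u => by rw [hL0]; rfl
  have hν0 : (fun u => μ 0 ((L 0).symm u)) = μ 0 := funext fun u => by rw [hL0u]
  have hM0 : (Matrix.of fun u v => M 0 ((L 0).symm u) ((L 0).symm v)) = M 0 := by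
    ext u v; rw [Matrix.of_apply, hL0u, hL0u]
  refine stFinFrozen_spectralGap_ge (μ := fun i u => μ i ((L i).symm u))
    (M := fun i => Matrix.of fun u v => M i ((L i).symm u) ((L i).symm v)) hK (fun k u => hμ k _)
    (fun k => by rw [Equiv.sum_comp (L k).symm (μ k)]; exact hμ1 k) (fun k => ⟨fun u v => (hM k).1 _ _, fun u => ?_⟩)
    (fun k u v => ?_) hp hp1 hγ₀ (fun k l u hkl => hpers k l u hkl) ?_
  · simpa using (Equiv.sum_comp (L k).symm (fun v => M k ((L k).symm u) v)).trans ((hM k).2 _)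
  · simp only [Matrix.of_apply]; exact hMrev k _ _
  · intro h
    have e1 : lawVariance (fun u => μ 0 ((L 0).symm u)) h = lawVariance (μ 0) h := by rw [hν0]
    have e2 : dirichletForm (fun u => μ 0 ((L 0).symm u)) (Matrix.of fun u v => M 0 ((L 0).symm u) ((L 0).symm v)) h
        = dirichletForm (μ 0) (M 0) h := by rw [hν0, hM0]
    rw [e1, e2]; exact hgap0 h

/-- **PERFECT COMPOSED TRANSPORTS:** `μ_k∘L_k⁻¹ = μ_0` for every level (`L_0 = 1`) ⇒
`Gap(stFlowSampler ½ μ M φ^L) ≥ min{1/K, γ₀}/(25(K+1))`, arbitrary cold laws and cold updates. [ours] -/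
theorem flowTemperingPerfect_spectralGap_ge (hL0 : L 0 = Equiv.refl S) (hK : 1 ≤ K) (hμ : ∀ k x, 0 < μ k x)
    (hμ1 : ∀ k, ∑ x, μ k x = 1) (hM : ∀ k, IsRowStochastic (M k)) (hMrev : ∀ k, DetailedBalance (μ k) (M k))
    (hperf : ∀ (i : Fin (K + 1)) (u : S), μ i ((L i).symm u) = μ 0 u) {γ₀ : ℝ} (hγ₀ : 0 < γ₀)
    (hgap0 : ∀ h : S → ℝ, γ₀ * lawVariance (μ 0) h ≤ dirichletForm (μ 0) (M 0) h) :
    min (1 / (K : ℝ)) γ₀ / (25 * (K + 1))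
      ≤ spectralGap (stFinLaw μ) (stFlowSampler (1 / 2) μ M (fun j : Fin K => (L j.castSucc).trans (L j.succ).symm)) := by
  have h := flowTempering_spectralGap_ge_frozen L (p := 1) hL0 hK hμ hμ1 hM hMrev one_pos le_rfl hγ₀
    (fun k l u _ => by rw [hperf l, hperf k, one_mul]) hgap0
  simpa using h

end Conj

/-- **ADJACENT MAPS THAT TRANSPORT EACH LEVEL ONTO THE NEXT MAKE TEMPERING BLIND TO THE LADDER'S OVERLAPS:**
`μ_{j+1}(φ_j u) = μ_j(u)` for all `j`, `u` ⇒ `Gap(stFlowSampler ½ μ M φ) ≥ min{1/K, γ₀}/(25(K+1))` — for every family of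
cold laws and every family of `μ_k`-reversible cold updates (`K ≥ 1`, hot Poincaré constant `γ₀`). [ours] -/
theorem flowTemperingPerfect_spectralGap_ge_of_adjacent (φ : Fin K → Equiv.Perm S) (hK : 1 ≤ K)
    (hμ : ∀ k x, 0 < μ k x) (hμ1 : ∀ k, ∑ x, μ k x = 1) (hM : ∀ k, IsRowStochastic (M k))
    (hMrev : ∀ k, DetailedBalance (μ k) (M k)) (hperfect : ∀ (j : Fin K) (u : S), μ j.succ (φ j u) = μ j.castSucc u)
    {γ₀ : ℝ} (hγ₀ : 0 < γ₀) (hgap0 : ∀ h : S → ℝ, γ₀ * lawVariance (μ 0) h ≤ dirichletForm (μ 0) (M 0) h) :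
    min (1 / (K : ℝ)) γ₀ / (25 * (K + 1)) ≤ spectralGap (stFinLaw μ) (stFlowSampler (1 / 2) μ M φ) := by
  obtain ⟨L, hL0, hLφ⟩ := exists_levelMaps φ
  have hφ : φ = fun j : Fin K => (L j.castSucc).trans (L j.succ).symm := (funext hLφ).symm
  have hstep : ∀ (j : Fin K) (u : S), (L j.succ).symm u = φ j ((L j.castSucc).symm u) := by
    intro j u
    have h := Equiv.ext_iff.mp (hLφ j) ((L j.castSucc).symm u)
    simp only [Equiv.trans_apply, Equiv.apply_symm_apply] at h
    exact h
  have hperf : ∀ (i : Fin (K + 1)) (u : S), μ i ((L i).symm u) = μ 0 u := by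
    intro i
    induction i using Fin.induction with
    | zero => intro u; rw [hL0]; rfl
    | succ j ih => intro u; rw [hstep j u, hperfect j, ih]
  rw [hφ]
  exact flowTemperingPerfect_spectralGap_ge L hL0 hK hμ hμ1 hM hMrev hperf hγ₀ hgap0

end Summit.Ventures.LatticeQCDFlow.Scaling

end
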